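import Summits.CriticalPhenomena.PercolationContinuityZ3.Theorems.Transplant.SkelNegBParamsLO
import Summits.CriticalPhenomena.PercolationContinuityZ3.Theorems.Transplant.SkelNeg1ChoiceAll
import HarnessLib

/-!
# N1 params, chain of record `NegB`, part 4: THE CHOICE FUNCTION OF THE {±1} NODE OF RECORD — `PlanarSkeletonNeg.negChoiceAllOB gv fv Pv Sv : ChoiceFnNO` with FOUR slots:
# `gv` (extra BOX floors on `M_L`: the bridge's `16(n_b+ℓ_b+|h_b|)`, the kit layer's), `fv` (extra WIDTH floors on `n_L`), `Pv` (extra admissible Step-I″ PAIRS: the (R) bridge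
# `(M_b, n_b)`, the kit-link pair `(M_kit, n_kit)`, WITH their admissibility), `Sv` (the q-level fibre block `SchedIn`); the schedule of record `NegB.schedOf`, the scheme of record
# `NegB.ΓO/FDO/LDO`, the `AtQO` unpacking, and **`geomHoldsNOFn_negChoiceAllOB : ∀ gv fv Pv Sv, GeomHoldsNOFn (negChoiceAllOB gv fv Pv Sv)`**

builds on p205010 (kernel theorem, internal audit signed; external expert review pending) — nothing in this file uses p205010; NOTHING is claimed about
the node `SamePDropOfSkeletonNeg₁` (OPEN): this file discharges the geometric obligation of `samePDropOfSkeletonNeg₁_of_choiceFnNO` for the choices of record, for every slot value;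
(R)/(F)/(C) are the residue seats'.  Supersedes `negChoiceAllOF` (p284221) / `negChoiceAllOP` (the `g = 0`, no-bridge readings).
Status sentence (coordinator 2026-08-20T04:30Z): "θ(p_c) = 0 on ℤ^d, all d ≥ 2 — kernel-verified (Lean 4/Mathlib, standard axioms); internal adversarial
audit SIGNED 2026-08-20 04:29Z; external expert review pending."
Lane `prim-bschramm-*`, seat `prim-bschramm-stmt` (gen 13); helper file (`--supports stmt-CriticalPhenomena-4575 --as helper`); ledger HOME/prim-bschramm-stmt/NEG-PARAMS.md v0.10;
interface of record = p3's `ChoiceNO` (p282003); (R) ruling B.13 (p3-g9 15:38:39Z).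
HOW TO STATE A RESIDUE THEOREM: `theorem xHoldsNOFn_negChoiceAllOB (gv fv : Neg.FSlot) (Pv : NegB.PSlot) (Sv : NegB.SSlot) (h… : your floors on gv/fv, your pairs ∈ (Pv …).1,
your reads of (Sv …)) : XHoldsNOFn (negChoiceAllOB gv fv Pv Sv)`; inside, after `intro κ V _ _ G _ Φ hg t ht h1 p hp0 hp1 hC O q hAt`, every value is `NegB.X κ Φ t p O.merged g f`
with `g := NegB.gOf κ Φ t p O gv`, `f := NegB.fOf κ Φ t p O fv`; inputs `inputsS/L/P_of_atQOB hAt …`; clauses `clauseL/S/P_of_atQOB hAt`; Φ2 / density window `factsO_of_atQOB hAt`.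
* §1 `NegB.PSlot` (+ `.empty`), `NegB.SSlot`, `NegB.offN/schedOf` (+ `_WFS2`, `colQ_schedOf`), `gOf/fOf`, `SMnP` (+ `_adm_at`), `ΓO/FDO/LDO`, `choiceAtOB`, **`negChoiceAllOB`** (+ `_eq`);
* §2 `factsO/eqNumL/clauseL/clauseS/clauseP/inputsP/inputsExtra/inputsS/inputsL/zone _of_atQOB`; §3 **`geomHoldsNOFn_negChoiceAllOB`**.
[cite: KozmaNitzan2024, §4 Theorem 6 (pp. 25–31): the order of constants; pp. 25–27] [cite: MartineauTassion2017, §3.2 Lemma 3.5, §4.3]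
-/

noncomputable section

open scoped Classical

namespace Summit.CriticalPhenomena.PercolationContinuityZ3.Theorems.Transplant

open MeasureTheory Literature.Probability.Percolation Literature.Probability.LatticeModels SimpleGraph KNCells
open Literature.Barriers.CriticalPhenomena (HasExponentialGrowth)

namespace PlanarSkeletonNeg

open SkelConc (Consts)
open BoxProdZ2 (ConcRadiiG)
open Skelφ (oriφ trφ)
open Skelφ.StepI (DataN OutO)

namespace NegB

open Neg

/-! ## §1 The slots, the schedule and scheme of record, the choice function -/

/-- **A pair slot**: a finite set of EXTRA admissible pairs `(M, n)` as a function of the p-fixed data, bundled with its admissibility. [this work] -/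
def PSlot : Type 1 :=
  ∀ (κ : Consts) {V : Type} [DecidableEq V] [Countable V] {G : SimpleGraph V} [G.LocallyFinite], PlanarSkeletonNeg G → V → unitInterval →
    ∀ D : DataN V, {S : Finset (ℕ × ℕ) // ∀ q ∈ S, D.M₀ ≤ q.1 ∧ D.n₁ q.1 ≤ q.2}

/-- The empty pair slot. [folklore] -/
def PSlot.empty : PSlot := fun _ _ _ _ _ _ _ _ _ _ => ⟨∅, fun _ h => absurd h (Finset.notMem_empty _)⟩

/-- **A schedule-input slot** (box slot, width slot, running density): the q-level fibre block `SchedIn`. [this work] -/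
def SSlot : Type 1 :=
  ∀ (κ : Consts) {V : Type} [DecidableEq V] [Countable V] {G : SimpleGraph V} [G.LocallyFinite],
    PlanarSkeletonNeg G → V → unitInterval → DataN V → ℕ → ℕ → unitInterval → Skelφ.Prm.SchedIn

section Values

variable (κ : Consts) {V : Type} [DecidableEq V] [Countable V] {G : SimpleGraph V} [G.LocallyFinite] (Φ : PlanarSkeletonNeg G) (t : V)
  (p : unitInterval) (D : DataN V) (g f : ℕ)

/-- **The column slot of record**: `offN w := Nrep (cen w) + 1`. [this work] -/
def offN : Site 2 → ℕ := fun w => Nrep κ Φ t p D g f ((fcells κ Φ t p D g f).cen w) + 1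

/-- **THE FIBRE SCHEDULE OF RECORD** from the q-level inputs `S`: `Prm.schedN S fcells offN`. [cite: KozmaNitzan2024, §4 pp. 25–26; Lemma 12 (p. 24)] -/
def schedOf (S : Skelφ.Prm.SchedIn) : ConcRadiiG := Skelφ.Prm.schedN S (fcells κ Φ t p D g f) (offN κ Φ t p D g f)

/-- **`WFS2 fcells (schedOf S)`** for every input block. [this work] -/
theorem schedOf_WFS2 (S : Skelφ.Prm.SchedIn) : Skelφ.WFS2 (fcells κ Φ t p D g f) (schedOf κ Φ t p D g f S) := Skelφ.Prm.schedN_WFS2 _ _ _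

/-- **The column floor**: `Nrep (cen x) + 1 ≤ rQ a x` at every `(a, x)`. [this work] -/
theorem colQ_schedOf (S : Skelφ.Prm.SchedIn) : ∀ a x, Nrep κ Φ t p D g f ((fcells κ Φ t p D g f).cen x) + 1 ≤ (schedOf κ Φ t p D g f S).rQ a x :=
  fun a x => Skelφ.Prm.off_le_schedN_rQ S (fcells κ Φ t p D g f) (offN κ Φ t p D g f) a x

variable (Pv : PSlot)

/-- **The extensible pair list**: `SMn ∪ extra`. [this work] -/
def SMnP : Finset (ℕ × ℕ) := SMn κ Φ t p D g f ∪ (Pv κ Φ t p D).1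

/-- The two ledger pairs are in the list. [folklore] -/
theorem SMn_subset_SMnP : SMn κ Φ t p D g f ⊆ SMnP κ Φ t p D g f Pv := Finset.subset_union_left

/-- The extra pairs are in the list. [folklore] -/
theorem extra_subset_SMnP : (Pv κ Φ t p D).1 ⊆ SMnP κ Φ t p D g f Pv := Finset.subset_union_right

/-- **Pair admissibility of the list.** [folklore] -/
theorem SMnP_adm_at : ∀ q ∈ SMnP κ Φ t p D g f Pv, D.M₀ ≤ q.1 ∧ D.n₁ q.1 ≤ q.2 := by
  intro q hq
  rcases Finset.mem_union.1 hq with h | h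
  · exact SMn_adm_at κ Φ t p D g f q h
  · exact (Pv κ Φ t p D).2 q h

variable (O : OutO V) (gv fv : Neg.FSlot) (Sv : SSlot) (q : unitInterval)

/-- The box floor AT the oriented output: `gv` at the merged record. [this work] -/
def gOf : ℕ := gv κ Φ t p O.merged

/-- The width clearance AT the oriented output: `fv` at the merged record. [this work] -/
def fOf : ℕ := fv κ Φ t p O.merged

/-- **THE ANCHORED-CELLS SCHEME OF RECORD at `(O, q)`**: `cellGeomSG₂` over the oriented fine map `fineO`, the cells `fcells`, root `t`, schedule `schedOf (Sv …)`.
[cite: KozmaNitzan2024, §4 pp. 25–27 (Q_v, M_v, E_{v,x}, H^j_{v,x})] -/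
def ΓO : CellGeom V ℕ :=
  Skelφ.cellGeomSG₂ G (fineO κ Φ t p O.D O.DT O.ori (gOf κ Φ t p O gv) (fOf κ Φ t p O fv))
    (fcells κ Φ t p O.merged (gOf κ Φ t p O gv) (fOf κ Φ t p O fv)) t
    (schedOf κ Φ t p O.merged (gOf κ Φ t p O gv) (fOf κ Φ t p O fv) (Sv κ Φ t p O.merged (gOf κ Φ t p O gv) (fOf κ Φ t p O fv) q))

/-- **The face data of record at `(O, q)`** (`faceDataSG`). [this work] -/
def FDO : FaceData V ℕ :=
  Skelφ.faceDataSG G (fineO κ Φ t p O.D O.DT O.ori (gOf κ Φ t p O gv) (fOf κ Φ t p O fv))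
    (fcells κ Φ t p O.merged (gOf κ Φ t p O gv) (fOf κ Φ t p O fv)) t
    (schedOf κ Φ t p O.merged (gOf κ Φ t p O gv) (fOf κ Φ t p O fv) (Sv κ Φ t p O.merged (gOf κ Φ t p O gv) (fOf κ Φ t p O fv) q))

/-- **The level data of record at `O`** (`levelDataS`). [this work] -/
def LDO : LevelData V ℕ :=
  Skelφ.levelDataS (fineO κ Φ t p O.D O.DT O.ori (gOf κ Φ t p O gv) (fOf κ Φ t p O fv)) (fcells κ Φ t p O.merged (gOf κ Φ t p O gv) (fOf κ Φ t p O fv))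

variable (hC : Φ.CylSubcritical p)

/-- **THE N1 CHOICES OF RECORD at `(κ, Φ, t, p)` with the four slots.** [cite: KozmaNitzan2024, §4 Theorem 6 (pp. 25–31)] -/
def choiceAtOB : ChoiceNO κ Φ t p hC where
  δI := Neg.δI κ Φ
  m₀ := Neg.m₀
  Sz := fun O => Neg.Sz O.merged
  SMn := fun O => SMnP κ Φ t p O.merged (gOf κ Φ t p O gv) (fOf κ Φ t p O fv) Pv
  Γ := fun O q => ΓO κ Φ t p O gv fv Sv q
  FD := fun O q => FDO κ Φ t p O gv fv Sv q
  LD := fun O _ => LDO κ Φ t p O gv fv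
  δI_pos := Neg.δI_pos κ Φ
  δI_lt_one := Neg.δI_lt_one κ Φ
  S_adm := fun O _ => ⟨Neg.Sz_adm O.merged, SMnP_adm_at κ Φ t p O.merged _ _ Pv⟩

end Values

end NegB

/-- **THE CHOICE FUNCTION OF THE {±1} NODE OF RECORD, four slots** (box `gv`, width `fv`, extra pairs `Pv`, fibre block `Sv`). [cite: KozmaNitzan2024, §4 Theorem 6 (pp. 25–31)] -/
def negChoiceAllOB (gv fv : Neg.FSlot) (Pv : NegB.PSlot) (Sv : NegB.SSlot) : ChoiceFnNO :=
  fun κ _ _ _ _ _ Φ _ t _ _ p _ _ hC => NegB.choiceAtOB κ Φ t p Pv gv fv Sv hC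

/-- `negChoiceAllOB` unfolds to `NegB.choiceAtOB` (by `rfl`). [folklore] -/
theorem negChoiceAllOB_eq (gv fv : Neg.FSlot) (Pv : NegB.PSlot) (Sv : NegB.SSlot) (κ : Consts) {V : Type} [DecidableEq V] [Countable V] (G : SimpleGraph V)
    [G.LocallyFinite] (Φ : PlanarSkeletonNeg G) (hg : ¬ HasExponentialGrowth G) (t : V) (ht : t ∈ Φ.types) (h1 : Φ.types = {t}) (p : unitInterval)
    (hp0 : 0 < (p : ℝ)) (hp1 : (p : ℝ) < 1) (hC : Φ.CylSubcritical p) :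
    negChoiceAllOB gv fv Pv Sv κ G Φ hg t ht h1 p hp0 hp1 hC = NegB.choiceAtOB κ Φ t p Pv gv fv Sv hC := rfl

/-! ## §2 Unpacking `AtQO` for the choices of record -/

namespace NegB

open Neg

section AtQ

variable {κ : Consts} {V : Type} [DecidableEq V] [Countable V] {G : SimpleGraph V} [G.LocallyFinite] {Φ : PlanarSkeletonNeg G} {t : V} {p : unitInterval}
  {hC : Φ.CylSubcritical p} {gv fv : Neg.FSlot} {Pv : PSlot} {Sv : SSlot} {O : OutO V} {q : unitInterval}

/-- `FactsO`, the density window and Φ2 at `q` out of `AtQO`. [folklore] -/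
theorem factsO_of_atQOB (hAt : (choiceAtOB κ Φ t p Pv gv fv Sv hC).AtQO O q) :
    O.FactsO Φ.frame hC Neg.m₀ t ∧ (p : ℝ) / 2 ≤ q ∧ (q : ℝ) ≤ p ∧ Φ.CylSubcritical q := ⟨hAt.1, hAt.2.1, hAt.2.2.1, hAt.2.2.2.2⟩

/-- **The numeric long clause at the merged record** out of `AtQO`. [this work] -/
theorem eqNumL_of_atQOB (hAt : (choiceAtOB κ Φ t p Pv gv fv Sv hC).AtQO O q) : EqNumL κ Φ t p O.merged (gOf κ Φ t p O gv) (fOf κ Φ t p O fv) :=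
  eqNumL_of_factsO κ Φ t p O.D O.DT O.ori _ _ hAt.1.shared.2.2.1 hAt.1.clauses

/-- **The long clause (oriented map `φL`, `|h_L| ≤ 10 n_L`)** out of `AtQO`. [this work] -/
theorem clauseL_of_atQOB (hAt : (choiceAtOB κ Φ t p Pv gv fv Sv hC).AtQO O q) :
    O.merged.EqGeom G (φL κ Φ t p O.D O.DT O.ori (gOf κ Φ t p O gv) (fOf κ Φ t p O fv)) t (ML κ Φ t p O.merged (gOf κ Φ t p O gv))
        (nL κ Φ t p O.merged (gOf κ Φ t p O gv) (fOf κ Φ t p O fv)) ∧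
      (hL κ Φ t p O.merged (gOf κ Φ t p O gv) (fOf κ Φ t p O fv)).natAbs ≤ 10 * nL κ Φ t p O.merged (gOf κ Φ t p O gv) (fOf κ Φ t p O fv) :=
  clauseL_of_factsO κ Φ t p O.D O.DT O.ori _ _ hAt.1.shared.2.2.1 hAt.1.clauses

/-- **The short clause (oriented map `φS`, `|h_s| ≤ 10 n_s`)** out of `AtQO`. [this work] -/
theorem clauseS_of_atQOB (hAt : (choiceAtOB κ Φ t p Pv gv fv Sv hC).AtQO O q) :
    O.merged.EqGeom G (φS t O.D O.DT O.ori (Φ := Φ)) t (Mu O.merged) (nS O.merged) ∧ (hS t O.merged).natAbs ≤ 10 * nS O.merged :=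
  Neg.clauseS_of_factsO Φ t O.D O.DT O.ori hAt.1.shared.2.2.1 hAt.1.clauses

/-- **The clause of ANY admissible pair** (in particular every extra pair: the bridge, the kit link). [this work] -/
theorem clauseP_of_atQOB (hAt : (choiceAtOB κ Φ t p Pv gv fv Sv hC).AtQO O q) {M n : ℕ} (hM : O.D.M₀ ≤ M) (hn : O.D.n₁ M ≤ n) :
    O.merged.EqGeom G (oriφ Φ.φ (O.ori t M n)) t M n ∧ (O.merged.hgt t M n).natAbs ≤ 10 * n :=
  Skelφ.StepI.orient_clause_all hAt.1.shared.2.2.1 hAt.1.clauses M hM n hn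

/-- **THE PIECE-LINKS OF ANY LISTED PAIR at `q`**: for `(M, n) ∈ SMnP`, the eight inputs at the oriented map over the merged record, accuracy `δI`. [this work] -/
theorem inputsP_of_atQOB (hAt : (choiceAtOB κ Φ t p Pv gv fv Sv hC).AtQO O q) {M n : ℕ}
    (hMn : (M, n) ∈ SMnP κ Φ t p O.merged (gOf κ Φ t p O gv) (fOf κ Φ t p O fv) Pv) (fam : Fin 2) (σ τ : ℤˣ) :
    1 - Neg.δI κ Φ < (bondPercolation G q).real (Skelφ.StepI.eventN G (oriφ Φ.φ (O.ori t M n)) O.merged (t, M, some (n, fam, σ, τ))) := by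
  obtain ⟨hΛ, hk, hR, -, -⟩ := hAt.1.shared
  have ht : t ∈ ({t} : Finset V) := Finset.mem_singleton_self t
  have hmem := Skelφ.StepI.mem_indexNP_some (Sz := Neg.Sz O.merged) ht hMn fam σ τ
  have h := hAt.2.2.2.1 _ hmem
  rwa [Skelφ.StepI.eventO_some_eq_eventN_orient Φ.φ hΛ hk hR] at h

/-- **The extra pairs' piece-links**: for `(M, n) ∈ (Pv …).1`. [this work] -/
theorem inputsExtra_of_atQOB (hAt : (choiceAtOB κ Φ t p Pv gv fv Sv hC).AtQO O q) {M n : ℕ} (hMn : (M, n) ∈ (Pv κ Φ t p O.merged).1) (fam : Fin 2) (σ τ : ℤˣ) :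
    1 - Neg.δI κ Φ < (bondPercolation G q).real (Skelφ.StepI.eventN G (oriφ Φ.φ (O.ori t M n)) O.merged (t, M, some (n, fam, σ, τ))) :=
  inputsP_of_atQOB hAt (extra_subset_SMnP κ Φ t p O.merged _ _ Pv hMn) fam σ τ

/-- **The short pair's piece-links** (`φS = oriφ Φ.φ (ori t M_u n_s)`). [this work] -/
theorem inputsS_of_atQOB (hAt : (choiceAtOB κ Φ t p Pv gv fv Sv hC).AtQO O q) (fam : Fin 2) (σ τ : ℤˣ) :
    1 - Neg.δI κ Φ <
      (bondPercolation G q).real (Skelφ.StepI.eventN G (φS t O.D O.DT O.ori (Φ := Φ)) O.merged (t, Mu O.merged, some (nS O.merged, fam, σ, τ))) :=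
  inputsP_of_atQOB hAt (SMn_subset_SMnP κ Φ t p O.merged _ _ Pv (mem_SMn κ Φ t p O.merged (gOf κ Φ t p O gv) (fOf κ Φ t p O fv)).1) fam σ τ

/-- **The long pair's piece-links** (`φL = oriφ Φ.φ (ori t M_L (n_L g f))`). [this work] -/
theorem inputsL_of_atQOB (hAt : (choiceAtOB κ Φ t p Pv gv fv Sv hC).AtQO O q) (fam : Fin 2) (σ τ : ℤˣ) :
    1 - Neg.δI κ Φ <
      (bondPercolation G q).real (Skelφ.StepI.eventN G (φL κ Φ t p O.D O.DT O.ori (gOf κ Φ t p O gv) (fOf κ Φ t p O fv)) O.merged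
        (t, ML κ Φ t p O.merged (gOf κ Φ t p O gv), some (nL κ Φ t p O.merged (gOf κ Φ t p O gv) (fOf κ Φ t p O fv), fam, σ, τ))) :=
  inputsP_of_atQOB hAt (SMn_subset_SMnP κ Φ t p O.merged _ _ Pv (mem_SMn κ Φ t p O.merged (gOf κ Φ t p O gv) (fOf κ Φ t p O fv)).2) fam σ τ

/-- **The uniqueness zone at `M_u`** (as the merged record's zone input, any map). [this work] -/
theorem zone_of_atQOB (hAt : (choiceAtOB κ Φ t p Pv gv fv Sv hC).AtQO O q) :
    1 - Neg.δI κ Φ < (bondPercolation G q).real (Skelφ.StepI.eventN G (φS t O.D O.DT O.ori (Φ := Φ)) O.merged (t, Mu O.merged, none)) := by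
  have ht : t ∈ ({t} : Finset V) := Finset.mem_singleton_self t
  have hmem := Skelφ.StepI.mem_indexNP_none (SMn := SMnP κ Φ t p O.merged (gOf κ Φ t p O gv) (fOf κ Φ t p O fv) Pv) ht (Mu_mem_Sz O.merged)
  have h := hAt.2.2.2.1 _ hmem
  rw [Skelφ.StepI.eventO_none_eq_eventN Φ.φ (φS t O.D O.DT O.ori (Φ := Φ))] at h
  exact h

end AtQ

end NegB

/-! ## §3 The geometric obligation of the choices of record -/

/-- **`GeomHoldsNOFn (negChoiceAllOB gv fv Pv Sv)` FOR EVERY SLOT VALUE**: root, `K₀ ≤ K`, `RunGeom`, `AnchGeom`, `SepGeom₂`, `ExitGeom`, `StepsGeom`, `LevelGeom` of the scheme of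
record (hp-8 g33's records over the non-step fine map + this column's `hψ0/hlip/hws/hcol`, `WFS2` and the column floor by construction). [cite: KozmaNitzan2024, §4 pp. 25–29] -/
theorem geomHoldsNOFn_negChoiceAllOB (gv fv : Neg.FSlot) (Pv : NegB.PSlot) (Sv : NegB.SSlot) : GeomHoldsNOFn (negChoiceAllOB gv fv Pv Sv) := by
  intro κ V _ _ G _ Φ hg t ht h1 p hp0 hp1 hC O q hAt
  obtain ⟨-, -, hR, -, -⟩ := hAt.1.shared
  obtain ⟨h1', h2, -, h4, h5, h6, h7, h8, h9⟩ := NegB.geom_fineO_of_factsO κ Φ t p O.D O.DT O.ori (NegB.gOf κ Φ t p O gv) (NegB.fOf κ Φ t p O fv) hR hAt.1.clauses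
    (NegB.schedOf_WFS2 κ Φ t p O.merged (NegB.gOf κ Φ t p O gv) (NegB.fOf κ Φ t p O fv)
      (Sv κ Φ t p O.merged (NegB.gOf κ Φ t p O gv) (NegB.fOf κ Φ t p O fv) q))
    (NegB.colQ_schedOf κ Φ t p O.merged (NegB.gOf κ Φ t p O gv) (NegB.fOf κ Φ t p O fv)
      (Sv κ Φ t p O.merged (NegB.gOf κ Φ t p O gv) (NegB.fOf κ Φ t p O fv) q))
  exact ⟨h1', h2, h4, h5, h6, h7, h8, h9⟩

end PlanarSkeletonNeg

end Summit.CriticalPhenomena.PercolationContinuityZ3.Theorems.Transplant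

end
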